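import Literature.Probability.Percolation.QuadLowestCrossingProofs
import HarnessLib

/-!
# Schramm–Smirnov's Lemma 6.1, case (3), moving the bottom side of a charted rectangle

Topic `Probability/Percolation`.  Companion of `QuadLowestCrossingProofs.lean`
(`SSContinuity.exists_topMove_bound`: O. Schramm, S. Smirnov, *On the scaling limits of planar
percolation*, Ann. Probab. 39 (2011), Lemma 6.1 case (3), for bond percolation at `p = 1/2` on
`δℤ²` drawn in the plane and quads charted by a homeomorphism `H : ℂ ≃ₜ ℂ` of straight
rectangles, moving the TOP side of the chart rectangle down).  Here the mirror image in the
real axis of the chart: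

* `SSContinuity.chartCrossed_of_negIm`, `SSContinuity.chartCrossed_negIm_trans_iff` — the
  reflection identity `ChartCrossed (negIm.trans H) a b c d δ ω ↔ ChartCrossed H a b (-d) (-c) δ ω`
  (a witnessing continuum `K ⊆ [a,b] × [c,d]` is replaced by `negIm '' K ⊆ [a,b] × [-d,-c]`;
  real parts, hence the side conditions `re = a`, `re = b`, are unchanged);
* `SSContinuity.exists_bottomMove_bound` — **Lemma 6.1 (3) moving the BOTTOM side up, with
  constants**: for every chart `H` and `ε > 0` there is `Δ₀ > 0`, and for `0 < Δt`, `0 < κ`,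
  `Δt + κ ≤ Δ₀` a `δ₀ > 0`, such that for all meshes `0 < δ < δ₀` and all rectangles of the
  standard family (`-7/4 ≤ a`, `b ≤ 7/4`, `3/2 ≤ b - a`, `-7/4 ≤ c`, `d ≤ 7/4`, `3/2 ≤ d - c`):
  `P_{1/2}(H([a,b]×[c,d]) crossed, H([a+κ, b-κ] × [c+Δt, d+κ]) not crossed) ≤ ε`
  (`exists_topMove_bound` for the reflected chart `negIm.trans H = H ∘ negIm` at the reflected
  rectangle `[a,b] × [-d,-c]`, which is again in the standard family, and the reflection
  identity).

Source: the printed proof of Lemma 6.1 treats case (3) "by duality" after case (2), for an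
arbitrary side of the quad; the tree's `exists_topMove_bound` fixes the top side of the chart
rectangle, and the bottom side is obtained here from the chart symmetry `x + iy ↦ x - iy`
(`negIm`).  Everything is proved; no named fact is introduced.  Not here: the moves of the
vertical sides (`exists_move_bound` and its reflection by `negRe`).

## References

* O. Schramm, S. Smirnov, Ann. Probab. 39 (2011) 1768–1814, arXiv:1101.5820, Lemma 6.1 (3) and
  its proof ("case (3) by duality", pp. 22–23). [SchrammSmirnov2011]
-/

noncomputable section

open Set Complex
open scoped ENNReal
open Literature.Probability.LatticeModels

namespace Literature.Probability.Percolation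

namespace SSContinuity

open _root_.MeasureTheory _root_.Topology

/-- **Reflecting a chart crossing in the real axis.**  If `G' = G ∘ negIm` pointwise and the
chart rectangle `[a,b] × [c,d]` is crossed through `G'`, then `[a,b] × [-d,-c]` is crossed
through `G`: the witnessing continuum `K` is replaced by `negIm '' K` (compact, connected, with
the same real parts, and `G (negIm u) = G' u` is drawn onto the open edges). [folklore] -/
theorem chartCrossed_of_negIm {G G' : ℂ ≃ₜ ℂ} (hG : ∀ u, G' u = G (negIm u))
    {a b c d δ : ℝ} {ω : BondConfig (Site 2)} (h : ChartCrossed G' a b c d δ ω) :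
    ChartCrossed G a b (-d) (-c) δ ω := by
  obtain ⟨K, hKsub, hKc, hKconn, hKO, ⟨ua, hua, huare⟩, ⟨ub, hub, hubre⟩⟩ := h
  refine ⟨negIm '' K, ?_, hKc.image negIm.continuous,
    hKconn.image _ negIm.continuous.continuousOn, ?_,
    ⟨_, ⟨ua, hua, rfl⟩, by simpa using huare⟩, ⟨_, ⟨ub, hub, rfl⟩, by simpa using hubre⟩⟩
  · rintro _ ⟨u, hu, rfl⟩
    have h := hKsub hu
    rw [mem_reProdIm] at h ⊢
    simp only [negIm_re, negIm_im, mem_Icc] at h ⊢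
    exact ⟨h.1, by linarith [h.2.2], by linarith [h.2.1]⟩
  · rintro _ ⟨u, hu, rfl⟩
    rw [← hG]
    exact hKO u hu

/-- **The reflection identity** for the reflected chart `negIm.trans H = H ∘ negIm`:
`[a,b] × [c,d]` is crossed through `H ∘ negIm` iff `[a,b] × [-d,-c]` is crossed through `H`
(`chartCrossed_of_negIm` both ways, `negIm` being an involution). [folklore] -/
theorem chartCrossed_negIm_trans_iff (H : ℂ ≃ₜ ℂ) (a b c d δ : ℝ) (ω : BondConfig (Site 2)) :
    ChartCrossed (negIm.trans H) a b c d δ ω ↔ ChartCrossed H a b (-d) (-c) δ ω := by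
  constructor
  · exact chartCrossed_of_negIm (G := H) (G' := negIm.trans H) fun _ => rfl
  · intro h
    have h' := chartCrossed_of_negIm (G := negIm.trans H) (G' := H)
      (fun u => by simp [Homeomorph.trans_apply, negIm_negIm]) h
    simpa only [neg_neg] using h'

/-- **Schramm–Smirnov's Lemma 6.1, case (3), moving the bottom side, for charted rectangles on
bond-`ℤ²` — with constants.**  For every chart `H` and `ε > 0` there is `Δ₀ > 0`, and for all
`0 < Δt`, `0 < κ` with `Δt + κ ≤ Δ₀` a `δ₀ > 0`, such that for all meshes `0 < δ < δ₀` and all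
rectangles of the standard family (`-7/4 ≤ a`, `b ≤ 7/4`, `3/2 ≤ b - a`, `-7/4 ≤ c`, `d ≤ 7/4`,
`3/2 ≤ d - c`):
`P_{1/2}(H([a,b]×[c,d]) crossed, H([a+κ, b-κ] × [c+Δt, d+κ]) not crossed) ≤ ε`.
(`exists_topMove_bound` for the reflected chart `negIm.trans H` at the reflected rectangle
`[a,b] × [-d,-c]` — again in the standard family — with the same `Δ₀`, `δ₀`; both events are
rewritten by the reflection identity `chartCrossed_negIm_trans_iff`, and
`-(-c - Δt) = c + Δt`, `-(-d - κ) = d + κ`.) [cite: SchrammSmirnov2011, Lemma 6.1 (3)] -/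
theorem exists_bottomMove_bound (H : ℂ ≃ₜ ℂ) {ε : ℝ} (hε : 0 < ε) :
    ∃ Δ₀ : ℝ, 0 < Δ₀ ∧ ∀ Δt κ : ℝ, 0 < Δt → 0 < κ → Δt + κ ≤ Δ₀ → ∃ δ₀ : ℝ, 0 < δ₀ ∧
      ∀ δ : ℝ, 0 < δ → δ < δ₀ → ∀ a b c d : ℝ, -7 / 4 ≤ a → b ≤ 7 / 4 → 3 / 2 ≤ b - a →
        -7 / 4 ≤ c → d ≤ 7 / 4 → 3 / 2 ≤ d - c →
          bondPercolation (zdGraph 2) half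
            {ω | ChartCrossed H a b c d δ ω ∧ ¬ ChartCrossed H (a + κ) (b - κ) (c + Δt) (d + κ) δ ω} ≤
            ENNReal.ofReal ε := by
  obtain ⟨Δ₀, hΔ₀, htop⟩ := exists_topMove_bound (negIm.trans H) hε
  refine ⟨Δ₀, hΔ₀, fun Δt κ hΔt hκ hsum => ?_⟩
  obtain ⟨δ₀, hδ₀, htop'⟩ := htop Δt κ hΔt hκ hsum
  refine ⟨δ₀, hδ₀, fun δ hδ hδδ₀ a b c d ha hb hab hc hd hcd => ?_⟩
  have key := htop' δ hδ hδδ₀ a b (-d) (-c) ha hb hab (by linarith) (by linarith) (by linarith)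
  have e₁ : -(-c - Δt) = c + Δt := by ring
  have e₂ : -(-d - κ) = d + κ := by ring
  have hset :
      {ω | ChartCrossed H a b c d δ ω ∧ ¬ ChartCrossed H (a + κ) (b - κ) (c + Δt) (d + κ) δ ω} =
        {ω | ChartCrossed (negIm.trans H) a b (-d) (-c) δ ω ∧
          ¬ ChartCrossed (negIm.trans H) (a + κ) (b - κ) (-d - κ) (-c - Δt) δ ω} := by
    ext ω
    simp only [mem_setOf_eq]
    rw [chartCrossed_negIm_trans_iff, chartCrossed_negIm_trans_iff, neg_neg, neg_neg, e₁, e₂]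
  rw [hset]
  exact key

end SSContinuity

end Literature.Probability.Percolation
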